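import Mathlib
import Summits.Ventures.PercRepro2.PMK5Deg5LocusBern

/-!
# THE FIVE CLASSES OF `K₆(M)` IN THE TREE'S VOCABULARY: `FiveClass15 M` AS CONNECTIVITY STATEMENTS ABOUT THE
OPEN SUBGRAPH (blind cell PercRepro2, mine-2 g32)

`FiveClass15 M` (`PMK5Deg5LocusBern.lean`) is a Boolean on the bitmask closure `Deg5.conn`; through
`Deg5Conn.conn_iff'` (the closure is the tree's `Conn ends15`) each clause is a statement about reachability in
the open subgraph of `K₆` with the edge set `M` — `cfg15 M` — or with the edges at some marks removed
(`cfgAvoid15 M r`, `cfgAvoid2_15 M r s`): **`fiveClass15_iff`**.  Marks `o = 0, a₁ = 1, a₂ = 2, a₃ = 5, b = 4`.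
Standard axioms.
-/

namespace Summit.Ventures.PercRepro2

namespace Deg5

namespace Locus

/-- The trivial class, as a proposition: `o` or `b` is connected to neither root in `K₆(M)`. -/
def TrivialP (M : ℕ) : Prop :=
  (¬ Conn ends15 (cfg15 M) 0 1 ∧ ¬ Conn ends15 (cfg15 M) 0 2) ∨
    (¬ Conn ends15 (cfg15 M) 4 1 ∧ ¬ Conn ends15 (cfg15 M) 4 2)

/-- (SEP-2): `o` is not connected to `b` once the edges at `a₁` and at `a₂` are removed. -/
def Sep2P (M : ℕ) : Prop := ¬ Conn ends15 (cfgAvoid2_15 M 1 2) 0 4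

/-- (SEP-3): `o` is connected neither to `a₂` nor to `b` once the edges at `a₁` and at `a₃` are removed. -/
def Sep3P (M : ℕ) : Prop :=
  ¬ Conn ends15 (cfgAvoid2_15 M 1 5) 0 2 ∧ ¬ Conn ends15 (cfgAvoid2_15 M 1 5) 0 4

/-- (SEP-3), the mirror. -/
def Sep3P' (M : ℕ) : Prop :=
  ¬ Conn ends15 (cfgAvoid2_15 M 2 5) 0 1 ∧ ¬ Conn ends15 (cfgAvoid2_15 M 2 5) 0 4

/-- (A3-O): `o` is connected to neither root once the edges at `a₃` are removed. -/
def A3OP (M : ℕ) : Prop :=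
  ¬ Conn ends15 (cfgAvoid15 M 5) 0 1 ∧ ¬ Conn ends15 (cfgAvoid15 M 5) 0 2

/-- (ONE-ROOT): `a₁` is connected to none of `o`, `b`, `a₃` once the edges at `a₂` are removed. -/
def OneRootP (M : ℕ) : Prop :=
  ¬ Conn ends15 (cfgAvoid15 M 2) 1 0 ∧ ¬ Conn ends15 (cfgAvoid15 M 2) 1 4 ∧ ¬ Conn ends15 (cfgAvoid15 M 2) 1 5

/-- (ONE-ROOT), the mirror. -/
def OneRootP' (M : ℕ) : Prop :=
  ¬ Conn ends15 (cfgAvoid15 M 1) 2 0 ∧ ¬ Conn ends15 (cfgAvoid15 M 1) 2 4 ∧ ¬ Conn ends15 (cfgAvoid15 M 1) 2 5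

/-- A non-connection of the closure is a non-connection of the open subgraph. -/
lemma nconn_iff (ω : Fin 15 → Bool) {u v : ℕ} (hu : u < 6) (hv : v < 6) :
    (!conn ω u v) = true ↔ ¬ Conn ends15 ω ⟨u, hu⟩ ⟨v, hv⟩ := by
  rw [Bool.not_eq_true', ← conn_iff' ω hu hv]
  exact ⟨fun h => by rw [h]; decide, fun h => by rcases Bool.eq_false_or_eq_true (conn ω u v) with h' | h' <;>
    simp_all⟩

/-- **The five classes in the tree's vocabulary**: `FiveClass15 M = true` iff `K₆(M)` satisfies one of the
five connectivity conditions of Theorem 8.1. -/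
theorem fiveClass15_iff (M : ℕ) :
    FiveClass15 M = true ↔
      TrivialP M ∨ Sep2P M ∨ Sep3P M ∨ Sep3P' M ∨ A3OP M ∨ OneRootP M ∨ OneRootP' M := by
  unfold FiveClass15 Trivial15 Sep2_15 Sep3_15 Sep3'_15 A3O15 OneRoot15 OneRoot'15 TrivialP Sep2P Sep3P Sep3P'
    A3OP OneRootP OneRootP'
  simp only [Bool.or_eq_true, Bool.and_eq_true]
  rw [nconn_iff _ (by norm_num) (by norm_num), nconn_iff _ (by norm_num) (by norm_num),
    nconn_iff _ (by norm_num) (by norm_num), nconn_iff _ (by norm_num) (by norm_num),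
    nconn_iff _ (by norm_num) (by norm_num), nconn_iff _ (by norm_num) (by norm_num),
    nconn_iff _ (by norm_num) (by norm_num), nconn_iff _ (by norm_num) (by norm_num),
    nconn_iff _ (by norm_num) (by norm_num), nconn_iff _ (by norm_num) (by norm_num),
    nconn_iff _ (by norm_num) (by norm_num), nconn_iff _ (by norm_num) (by norm_num),
    nconn_iff _ (by norm_num) (by norm_num), nconn_iff _ (by norm_num) (by norm_num),
    nconn_iff _ (by norm_num) (by norm_num), nconn_iff _ (by norm_num) (by norm_num),
    nconn_iff _ (by norm_num) (by norm_num)]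
  simp only [and_assoc, or_assoc]
  exact Iff.rfl

end Locus

end Deg5

end Summit.Ventures.PercRepro2
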